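import Summits.HodgeConjecture.CorCM.IrreducibleOddWeightsCoreTowerExact
import Summits.HodgeConjecture.CorCM.PointwiseConjugationCMFieldsHodge
import HarnessLib

/-!
# Core tower, IX: the level-two criterion implies POINTWISE PARTIAL CONJUGATION (PC); for a normal trace field,
# (PC) ⟺ no common CM subfield ⟺ additivity for all types

COR-CM (cell `pub-hodgecm2`, binder seat `b16` gen 67, count-neutral claim CORE TOWER, file A9; theorems only, no
definition, no named fact, no `sorry`).  NEW as stated, hence under `Summits/`.  HONEST FRAMING: Galois theory of two CM
fields inside `ℂ` and its consequences for `Hg(A₀ × A₁) = Hg(A₀) × Hg(A₁)`; the only Hodge classes claimed algebraic are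
those of the tree's nondegenerate-family theorem (Pohlmann–Gordon); `HC_CM` is neither used nor asserted.

SETTING.  CM fields `K_{i₀}, K_{i₁}`, `L₀ = normalClosure ℚ K_{i₀} ℂ`, `b₀ : K_{i₁} → ℂ`.  Gen 48's (PC) at the base point
`b₀`: for every `x : K_{i₀} → ℂ` some `σ ∈ Aut(ℂ)` has `σ ∘ x = x̄` and `σ ∘ b₀ = b₀`; (PC) ⟹ the two slots share no
constituent ⟹ `Hg(A₀ × A₁) = Hg(A₀) × Hg(A₁)` for all types, and `B• = D•` + HC on all products of nondegenerate
realisations (`PointwiseConjugationCMFieldsHodge`).  A2's LEVEL-TWO CRITERION: `T₁` a number field with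
`b(K_{i₁}) ∩ L₀ ⊆ L_{T₁}` for all `b` (canonically `L_{T₁} = E₁`, the Galois closure of the trace `K_{i₁} ∩ L₀`), and
`a(K_{i₀}) ∩ L_{T₁} ⊂ ℝ` for all `a`.

* §1 Galois lemmas in `Aut(ℂ)`: an automorphism fixing `b₀(K_{i₁}) ∩ L₀` pointwise acts on ALL embeddings of `K_{i₀}`
  like an automorphism fixing `b₀(K_{i₁})` pointwise (`exists_fix_forall_smul_eq_of_mem_closure`: the subgroup generated
  by `Aut(ℂ/b₀K_{i₁})` and the normal `Aut(ℂ/L₀)` is their product, and `Aut(ℂ/L₀)` fixes every embedding of `K_{i₀}`);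
  the subgroup generated by `Aut(ℂ/x(K_{i₀}))` and the NORMAL `Aut(ℂ/L_T)` is their product
  (`exists_mul_of_mem_closure_of_normalClosure`).
* §2 **`pointwiseConj_of_traces_le_of_forall_conj_apply_eq`: THE LEVEL-TWO CRITERION IMPLIES (PC)** — so the tower's
  type-free criterion sits inside gen 48's decision procedure (it never decides a pair that (PC) misses; its merit is
  that it is a FIELD-LATTICE test and comes with the exact defect and the exactness class).  Consequences through gen 48:
  `B• = D•` + HC on all products of nondegenerate realisations (`hodgeConjectureFor_prod_pair_of_traceClosure_real`).
* §3 **`pointwiseConj_iff_forall_conj_apply_eq_of_normal_trace`: FOR A NORMAL TRACE FIELD, (PC) ⟺ conjugation fixes every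
  `a(K_{i₀}) ∩ b₀(K_{i₁})`** ⟺ additivity for all types (A3) — three a priori different conditions coincide.

## References

* [Lang2002] S. Lang, *Algebra*, 3rd ed., VI §1 Thm. 1.1, Cor. 1.6, Thm. 1.12, Thm. 1.14 and V §2 Thm. 2.8.
* [Gordon1999HodgeAVSurvey] B. B. Gordon, *A survey of the Hodge conjecture for abelian varieties*, §3 Theorem (proof),
  7.5–7.7, 10.10.
* [Shimura1998] G. Shimura, *Abelian Varieties with Complex Multiplication and Modular Functions*, §8.3, §18.1, §18.2.
* [MoonenZarhin1999LowDim] B. Moonen, Yu. Zarhin, Math. Ann. 315 (1999), Thm. (0.2).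
-/

set_option autoImplicit false

noncomputable section

open scoped BigOperators Classical
open CategoryTheory CategoryTheory.Limits NumberField Module IntermediateField

namespace Summit.HodgeConjecture.CorCM

open Literature.NumberTheory.ComplexMultiplication Literature.AlgebraicGeometry.Pohlmann1968
open Literature.NumberTheory.NumberFields (mem_closure_fixing_union_of_apply_eq)
open Literature.AlgebraicGeometry.Motives (AbelianVariety CMType)
open Literature.AlgebraicGeometry.Motives.AbelianVariety
open Literature.AlgebraicGeometry.HodgeTheory
open Literature.AlgebraicGeometry.ComplexMultiplication (IsCMTypeRealisation)
open Literature.AlgebraicGeometry.VanGeemen1994 (hodgeClassSpan)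
open Literature.Barriers.HodgeConjecture (divisorClassesSpan)

/-! ### §1 Two product decompositions in `Aut(ℂ)` -/

section Galois

variable {I : Type} {K : I → Type} [∀ i, Field (K i)] [∀ i, NumberField (K i)]
  {T : Type} [Field T] [NumberField T]

omit [Field T] [NumberField T] in
/-- **`⟨Aut(ℂ/b₀K_{i₁}), Aut(ℂ/L₀)⟩` acts on `Hom(K_{i₀}, ℂ)` through `Aut(ℂ/b₀K_{i₁})`**: every element `s` of the subgroup
generated by the automorphisms fixing `b₀(K_{i₁})` pointwise and those fixing `L₀` pointwise acts on EVERY embedding of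
`K_{i₀}` like some `β` fixing `b₀(K_{i₁})` pointwise (`Aut(ℂ/L₀)` is normal and fixes every embedding of `K_{i₀}`).
[cite: Lang2002, VI §1 Thm. 1.1, Cor. 1.6 and Thm. 1.14] -/
theorem exists_fix_forall_smul_eq_of_mem_closure {i₀ i₁ : I} (b₀ : K i₁ →+* ℂ) {s : ℂ ≃+* ℂ}
    (hs : s ∈ Subgroup.closure
      ({σ : ℂ ≃+* ℂ | ∀ z : ℂ, z ∈ b₀.toRatAlgHom.fieldRange → σ z = z} ∪
        {σ : ℂ ≃+* ℂ | ∀ z : ℂ, z ∈ normalClosure ℚ (K i₀) ℂ → σ z = z})) :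
    ∃ β : ℂ ≃+* ℂ, (∀ z : ℂ, z ∈ b₀.toRatAlgHom.fieldRange → β z = z) ∧ ∀ x : K i₀ →+* ℂ, s • x = β • x := by
  induction hs using Subgroup.closure_induction with
  | mem s hs =>
    rcases hs with hs | hs
    · exact ⟨s, hs, fun x => rfl⟩
    · refine ⟨1, fun z _ => rfl, fun x => ?_⟩
      rw [one_smul]
      exact RingHom.ext fun k => by
        rw [ringEquiv_smul_apply]
        exact hs _ (apply_mem_normalClosure i₀ x k)
  | one => exact ⟨1, fun z _ => rfl, fun x => rfl⟩
  | mul s t _ _ hs ht =>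
    obtain ⟨β, hβ, hβx⟩ := hs
    obtain ⟨γ, hγ, hγx⟩ := ht
    refine ⟨β * γ, fun z hz => ?_, fun x => ?_⟩
    · rw [RingAut.mul_apply, hγ z hz, hβ z hz]
    · rw [mul_smul, mul_smul, hγx x, hβx (γ • x)]
  | inv s _ hs =>
    obtain ⟨β, hβ, hβx⟩ := hs
    refine ⟨β⁻¹, fun z hz => ?_, fun x => ?_⟩
    · rw [RingAut.inv_apply, RingEquiv.symm_apply_eq]
      exact (hβ z hz).symm
    · rw [inv_smul_eq_iff, hβx (β⁻¹ • x), smul_inv_smul]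

/-- **`⟨Aut(ℂ/x(K_{i₀})), Aut(ℂ/L_T)⟩ = Aut(ℂ/x(K_{i₀})) · Aut(ℂ/L_T)`**: the Galois closure `L_T` is stable under `Aut(ℂ)`,
so `Aut(ℂ/L_T)` is normal and the generated subgroup is the product set. [cite: Lang2002, VI §1 Thm. 1.1 and Thm. 1.14] -/
theorem exists_mul_of_mem_closure_of_normalClosure {i₀ : I} (x : K i₀ →+* ℂ) {s : ℂ ≃+* ℂ}
    (hs : s ∈ Subgroup.closure
      ({σ : ℂ ≃+* ℂ | ∀ z : ℂ, z ∈ x.toRatAlgHom.fieldRange → σ z = z} ∪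
        {σ : ℂ ≃+* ℂ | ∀ z : ℂ, z ∈ normalClosure ℚ T ℂ → σ z = z})) :
    ∃ α ν : ℂ ≃+* ℂ, (∀ z : ℂ, z ∈ x.toRatAlgHom.fieldRange → α z = z) ∧
      (∀ z : ℂ, z ∈ normalClosure ℚ T ℂ → ν z = z) ∧ s = α * ν := by
  -- conjugates of elements fixing `L_T` pointwise fix `L_T` pointwise
  have hconj : ∀ g ν : ℂ ≃+* ℂ, (∀ z : ℂ, z ∈ normalClosure ℚ T ℂ → ν z = z) →
      ∀ z : ℂ, z ∈ normalClosure ℚ T ℂ → (g⁻¹ * ν * g) z = z := by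
    intro g ν hν z hz
    rw [RingAut.mul_apply, RingAut.mul_apply,
      hν _ (ringEquiv_apply_mem_normalClosure (K := fun _ : Unit => T) () g hz), RingAut.inv_apply,
      RingEquiv.symm_apply_apply]
  induction hs using Subgroup.closure_induction with
  | mem s hs =>
    rcases hs with hs | hs
    · exact ⟨s, 1, hs, fun z _ => rfl, (mul_one s).symm⟩
    · exact ⟨1, s, fun z _ => rfl, hs, (one_mul s).symm⟩
  | one => exact ⟨1, 1, fun z _ => rfl, fun z _ => rfl, (mul_one _).symm⟩
  | mul s t _ _ hs ht =>
    obtain ⟨α, ν, hα, hν, rfl⟩ := hs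
    obtain ⟨α', ν', hα', hν', rfl⟩ := ht
    refine ⟨α * α', (α'⁻¹ * ν * α') * ν', fun z hz => ?_, fun z hz => ?_, by group⟩
    · rw [RingAut.mul_apply, hα' z hz, hα z hz]
    · rw [RingAut.mul_apply, hν' z hz, hconj α' ν hν z hz]
  | inv s _ hs =>
    obtain ⟨α, ν, hα, hν, rfl⟩ := hs
    refine ⟨α⁻¹, (α⁻¹)⁻¹ * ν⁻¹ * α⁻¹, fun z hz => ?_, fun z hz => ?_, by group⟩
    · rw [RingAut.inv_apply, RingEquiv.symm_apply_eq]
      exact (hα z hz).symm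
    · refine hconj α⁻¹ ν⁻¹ (fun w hw => ?_) z hz
      rw [RingAut.inv_apply, RingEquiv.symm_apply_eq]
      exact (hν w hw).symm

end Galois

/-! ### §2 The level-two criterion implies (PC) -/

section PC

variable {I : Type} {K : I → Type} [∀ i, Field (K i)] [∀ i, NumberField (K i)] [∀ i, IsCMField (K i)]
  {T : Type} [Field T] [NumberField T]

/-- **THE LEVEL-TWO CRITERION IMPLIES POINTWISE PARTIAL CONJUGATION.**  If `b(K_{i₁}) ∩ L₀ ⊆ L_T` for every `b` and
conjugation fixes `a(K_{i₀}) ∩ L_T` pointwise for every `a`, then for every `x : K_{i₀} → ℂ` some `σ ∈ Aut(ℂ)` satisfies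
`σ ∘ x = x̄` and `σ ∘ b₀ = b₀`.  (Conjugation lies in `Aut(ℂ/x K_{i₀}) · Aut(ℂ/L_T)` by the Galois correspondence; the second
factor fixes `b₀(K_{i₁}) ∩ L₀`, so acts on the embeddings of `K_{i₀}` like an automorphism `β` fixing `b₀(K_{i₁})`; take
`σ = β`.) [cite: Lang2002, VI §1 Thm. 1.1, Cor. 1.6, Thm. 1.14 and V §2 Thm. 2.8] [cite: Shimura1998, §18.1 and §18.2] -/
theorem pointwiseConj_of_traces_le_of_forall_conj_apply_eq {i₀ i₁ : I} (b₀ : K i₁ →+* ℂ)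
    (hT₁ : ∀ (b : K i₁ →+* ℂ) (k : K i₁), b k ∈ normalClosure ℚ (K i₀) ℂ → b k ∈ normalClosure ℚ T ℂ)
    (hreal : ∀ (a : K i₀ →+* ℂ) (k : K i₀), a k ∈ normalClosure ℚ T ℂ → starRingEnd ℂ (a k) = a k)
    (x : K i₀ →+* ℂ) :
    ∃ σ : ℂ ≃+* ℂ, σ • x = (starRingAut : ℂ ≃+* ℂ) • x ∧ σ • b₀ = b₀ := by
  haveI : FiniteDimensional ℚ (x.toRatAlgHom).fieldRange :=
    LinearEquiv.finiteDimensional (AlgEquiv.ofInjectiveField x.toRatAlgHom).toLinearEquiv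
  haveI : FiniteDimensional ℚ (b₀.toRatAlgHom).fieldRange :=
    LinearEquiv.finiteDimensional (AlgEquiv.ofInjectiveField b₀.toRatAlgHom).toLinearEquiv
  -- (1) conjugation fixes `x(K_{i₀}) ∩ L_T`, hence `conj = α ν`, `α` fixing `x(K_{i₀})`, `ν` fixing `L_T`
  have hfix : ∀ z : ℂ, z ∈ x.toRatAlgHom.fieldRange → z ∈ normalClosure ℚ T ℂ →
      (starRingAut : ℂ ≃+* ℂ) z = z := by
    intro z hz hzT
    obtain ⟨k, rfl⟩ := AlgHom.mem_fieldRange.1 hz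
    rw [starRingAut_apply, ← starRingEnd_apply]
    exact hreal x k hzT
  obtain ⟨α, ν, hα, hν, hconj⟩ :=
    exists_mul_of_mem_closure_of_normalClosure (T := T) x (mem_closure_fixing_union_of_apply_eq hfix)
  -- (2) `ν` fixes `b₀(K_{i₁}) ∩ L₀ ⊆ L_T`, hence acts on `Hom(K_{i₀}, ℂ)` like some `β ∈ Aut(ℂ/b₀K_{i₁})`
  have hνfix : ∀ z : ℂ, z ∈ b₀.toRatAlgHom.fieldRange → z ∈ normalClosure ℚ (K i₀) ℂ → ν z = z := by
    intro z hz hz₀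
    obtain ⟨k, rfl⟩ := AlgHom.mem_fieldRange.1 hz
    exact hν _ (hT₁ b₀ k hz₀)
  obtain ⟨β, hβ, hβx⟩ := exists_fix_forall_smul_eq_of_mem_closure (i₀ := i₀) b₀
    (mem_closure_fixing_union_of_apply_eq hνfix)
  refine ⟨β, ?_, RingHom.ext fun k => ?_⟩
  · -- `β • x = ν • x = α⁻¹ • (conj • x) = conj • x` (`α⁻¹` fixes `x(K_{i₀}) ∋ conj (x k)`)
    rw [← hβx x]
    have e : ν = α⁻¹ * (starRingAut : ℂ ≃+* ℂ) := by rw [hconj, inv_mul_cancel_left]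
    rw [e, mul_smul]
    refine RingHom.ext fun k => ?_
    rw [ringEquiv_smul_apply, ringEquiv_smul_apply, starRingAut_apply, ← starRingEnd_apply,
      ← IsCMField.complexEmbedding_complexConj, RingAut.inv_apply, RingEquiv.symm_apply_eq]
    exact (hα _ ⟨_, rfl⟩).symm
  · rw [ringEquiv_smul_apply]
    exact hβ _ ⟨k, rfl⟩

/-- **Canonical form**: if conjugation fixes `a(K_{i₀}) ∩ E₁` pointwise for every `a` (`E₁` the Galois closure of the trace
field `b₀⁻¹(L₀)`), then (PC) holds at the base point `b₀`. [cite: Lang2002, VI §1 Thm. 1.1, Cor. 1.6 and Thm. 1.12] -/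
theorem pointwiseConj_of_forall_conj_apply_eq_traceClosure {i₀ i₁ : I} (b₀ : K i₁ →+* ℂ)
    (hreal : ∀ (a : K i₀ →+* ℂ) (k : K i₀),
      a k ∈ normalClosure ℚ ↥((normalClosure ℚ (K i₀) ℂ).comap b₀.toRatAlgHom) ℂ → starRingEnd ℂ (a k) = a k)
    (x : K i₀ →+* ℂ) :
    ∃ σ : ℂ ≃+* ℂ, σ • x = (starRingAut : ℂ ≃+* ℂ) • x ∧ σ • b₀ = b₀ :=
  pointwiseConj_of_traces_le_of_forall_conj_apply_eq b₀
    (fun b k hk => apply_mem_normalClosure_comap_of_mem (T := K i₀) b₀ b k hk) hreal x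

variable [Fintype I] [DecidableEq I] {Φ : ∀ i, CMType (K i)} {A : I → AbelianVariety ℂ}
  {ι : ∀ i, 𝓞 (K i) →+* End (A i)} {θ : ∀ i, K i →+* Module.End ℂ (complexBetti (A i).X 1)}

/-- **`B• = D•` AND THE HODGE CONJECTURE ON ALL PRODUCTS under the level-two criterion, for nondegenerate types** —
through gen 48: the level-two criterion gives (PC), and (PC) with nondegenerate types gives a nondegenerate family, whose
products of powers have all Hodge classes generated by divisor classes (tree's Pohlmann–Gordon theorem).
[cite: Gordon1999HodgeAVSurvey, 10.10 and 7.5–7.7] [cite: MoonenZarhin1999LowDim, Thm. (0.2)] -/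
theorem hodgeConjectureFor_prod_pair_of_traceClosure_real {i₀ i₁ : I} (h01 : i₀ ≠ i₁)
    (hI : ∀ j, j = i₀ ∨ j = i₁) (b₀ : K i₁ →+* ℂ)
    (hreal : ∀ (a : K i₀ →+* ℂ) (k : K i₀),
      a k ∈ normalClosure ℚ ↥((normalClosure ℚ (K i₀) ℂ).comap b₀.toRatAlgHom) ℂ → starRingEnd ℂ (a k) = a k)
    (hΦ : ∀ i, IsNondegenerate (Φ i)) (hA : ∀ i, IsCMTypeRealisation (Φ i) (A i) (ι i) (θ i)) {N : ℕ}
    (π : Fin N → I) :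
    HodgeConjectureFor (⨁ fun j : Fin N => A (π j)).dim (⨁ fun j : Fin N => A (π j)).X ∧
      ∀ m : ℕ, hodgeClassSpan (⨁ fun j : Fin N => A (π j)).dim (⨁ fun j : Fin N => A (π j)).X m =
        divisorClassesSpan (⨁ fun j : Fin N => A (π j)).X (⨁ fun j : Fin N => A (π j)).dim m :=
  hodgeConjectureFor_prod_pair_of_pointwiseConj h01 hI b₀
    (pointwiseConj_of_forall_conj_apply_eq_traceClosure b₀ hreal) hΦ hA π

end PC

/-! ### §3 Normal trace: (PC), real intersections and additivity coincide -/

section Normal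

variable {I : Type} [Fintype I] {K : I → Type} [∀ i, Field (K i)] [∀ i, NumberField (K i)] [∀ i, IsCMField (K i)]

/-- **FOR A NORMAL TRACE FIELD, (PC) ⟺ CONJUGATION FIXES EVERY `a(K_{i₀}) ∩ b₀(K_{i₁})`.**  (`⟹`: (PC) gives additivity
for all types (gen 48), which forces real intersections (A7); `⟸`: a normal trace has `E₁ ⊆ b₀(K_{i₁})`, so the
hypothesis is the level-two criterion, which gives (PC) by §2.)  With A3: both are equivalent to
`Hg(A₀ × A₁) = Hg(A₀) × Hg(A₁)` for all CM types. [cite: Lang2002, VI §1 Thm. 1.1, Cor. 1.6 and Thm. 1.14]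
[cite: Gordon1999HodgeAVSurvey, §3 Theorem (proof) and 7.5–7.7] -/
theorem pointwiseConj_iff_forall_conj_apply_eq_of_normal_trace {i₀ i₁ : I} (h01 : i₀ ≠ i₁)
    (hI : ∀ l, l = i₀ ∨ l = i₁) (b₀ : K i₁ →+* ℂ)
    (hn : Normal ℚ ↥((normalClosure ℚ (K i₀) ℂ).comap b₀.toRatAlgHom)) :
    (∀ x : K i₀ →+* ℂ, ∃ σ : ℂ ≃+* ℂ, σ • x = (starRingAut : ℂ ≃+* ℂ) • x ∧ σ • b₀ = b₀) ↔
      ∀ (a : K i₀ →+* ℂ) (k : K i₀), a k ∈ b₀.toRatAlgHom.fieldRange → starRingEnd ℂ (a k) = a k := by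
  constructor
  · intro hpt
    exact (forall_cmFamilyRank_add_card_eq_iff_of_normal_trace h01 hI b₀ hn).1
      fun Φ => cmFamilyRank_add_card_eq_pair_of_pointwiseConj h01 hI Φ b₀ hpt
  · intro hreal x
    exact pointwiseConj_of_forall_conj_apply_eq_traceClosure b₀
      (fun a k hk => hreal a k (traceClosure_le_fieldRange_of_normal_trace b₀ hn hk)) x

/-- **… hence, for a normal trace field, (PC) ⟺ additivity for all CM types** (gen 48 proved `⟹` for all pairs and `⟸`
for NONDEGENERATE types; here `⟸` holds for the field pair itself). [cite: Gordon1999HodgeAVSurvey, §3 Theorem (proof)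
and 7.5–7.7] [cite: Lang2002, VI §1 Thm. 1.1 and Cor. 1.6] -/
theorem pointwiseConj_iff_forall_cmFamilyRank_add_card_eq_of_normal_trace {i₀ i₁ : I} (h01 : i₀ ≠ i₁)
    (hI : ∀ l, l = i₀ ∨ l = i₁) (b₀ : K i₁ →+* ℂ)
    (hn : Normal ℚ ↥((normalClosure ℚ (K i₀) ℂ).comap b₀.toRatAlgHom)) :
    (∀ x : K i₀ →+* ℂ, ∃ σ : ℂ ≃+* ℂ, σ • x = (starRingAut : ℂ ≃+* ℂ) • x ∧ σ • b₀ = b₀) ↔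
      ∀ Φ : ∀ i, CMType (K i), CMAlgebra.cmFamilyRank Φ + Fintype.card I = (∑ i, cmTypeRank (Φ i)) + 1 := by
  rw [pointwiseConj_iff_forall_conj_apply_eq_of_normal_trace h01 hI b₀ hn,
    forall_cmFamilyRank_add_card_eq_iff_of_normal_trace h01 hI b₀ hn]

end Normal

end Summit.HodgeConjecture.CorCM

end
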